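import Mathlib
import Literature.Probability.LatticeModels.ProdBernoulliIndependence
import Literature.Probability.Percolation.ConditionalPositiveAssociation
import Literature.Probability.Percolation.ConditionalPositiveAssociationProofs
import Literature.Probability.Percolation.TwoClusterConditionalAssociation
import Literature.Probability.Percolation.PercolationProofs
import Literature.Probability.Percolation.ClusterBoundary
import Literature.Probability.Percolation.FiniteEnergy
import Literature.Probability.Percolation.KozmaNitzanPinning
import Summits.CriticalPhenomena.PercolationContinuityZ3.Theorems.PercNearOneGluingNearOneGluingPocketBoundAux
import HarnessLib

/-!
# Crux `PercNearOneGluing.NearOneGluing` (stmt-CriticalPhenomena-4574), line `bhk-dyadic-thinning` — sub-goal `pocketBound`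

Helper file for the crux (lead prover-line-stmt-CriticalPhenomena-4574-0, wave 2): tooling / partial result
for the residual `stub_doomWindow`.  Proves exactly the registered sub-goal signature; lands with
`--supports stmt-CriticalPhenomena-4574`.

## Content: THE POCKET BOUND

For `μ = prodBernoulli w` on the pairs of `Fin n`, a finite set `A ∌ o` and a vertex `b`, with
`t ≥ max_{a ∈ A} μ(a ↮ b)`:
`μ(o ↔ A, o ↮ b) ≤ Σ_{S₀ ∋ o, S₀ ∩ A = ∅} min(μ(pocket = S₀), t · μ(S₀ internally o-spanned))`,
where the *relay-free pocket* of `ω` is `{v | o ↔ v using only vertices outside A}` and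
`{pocket = S₀} = {ω | ∀ v, ω ∈ openConnIn (↑A)ᶜ o v ↔ v ∈ S₀}`; granted, as hypothesis, the
*depth-one additive gluing* inequality (Kozma–Nitzan 2024, Thm. 4 in the form: if `s` has
positive-weight pairs only towards `A` and `μ(a ↮ b) ≤ t` on `A`, then `μ(s ↔ A, s ↮ b) ≤ t`).

Proof. Partition the bad event by the value `S₀` of the pocket. On `{pocket = S₀}`, every vertex
of `S₀` is joined to `o` inside `S₀` (`mem_openConnIn_of_pocket`) and every *boundary pair*
(`S₀` to a vertex outside `S₀ ∪ A`) is closed (`notMem_of_pocket`). Contract `S₀` to `o`: the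
fiber map `Φ` of the companion file `…PocketBoundAux.lean` keeps the pairs avoiding `S₀`, merges
the pairs `{x, a}` (`x ∈ S₀`, `a ∈ A`) onto `{o, a}` and deletes the rest; its law is the product
measure `prodBernoulli w'` (`prodBernoulli_real_preimage_fiberMap`), `o` is `w'`-isolated off
`A`, and `Φ⁻¹` of any event is determined by the pairs that are neither inside `S₀` nor boundary
pairs, hence independent of the spanning event (pairs inside `S₀`) and of the closed-boundary
event. The walk lemma `merge_mem_bad` puts `{bad} ∩ {pocket = S₀}` inside
`{span} ∩ {boundary closed} ∩ Φ⁻¹{bad}`, and `merge_mem_openConn` gives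
`μ'(a ↮ b) · μ(boundary closed) ≤ μ(a ↮ b) ≤ t`; depth-one gluing in the merged world then yields
`μ(boundary closed) · μ'(bad) ≤ t`, whence the per-pocket bound `pocket_term_le`.
-/

namespace Summit.CriticalPhenomena.PercolationContinuityZ3.Theorems

open scoped BigOperators Classical
open MeasureTheory Set
open Literature.Probability.LatticeModels (prodBernoulli prodBernoulli_real_inter_of_determinedBy)
open Literature.Probability.Percolation

section PocketWalks

variable {n : ℕ} {S₀ A : Finset (Fin n)} {o : Fin n}
  {Φ : Set (Sym2 (Fin n)) → Set (Sym2 (Fin n))} {F₀ : Finset (Sym2 (Fin n))}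

/-- **On `{pocket = S₀}` every vertex of `S₀` is joined to `o` inside `S₀`** (a path inside
`U` from `o` stays in the pocket). -/
theorem mem_openConnIn_of_pocket {U : Set (Fin n)} {ω : Set (Sym2 (Fin n))}
    (hω : ∀ v, ω ∈ openConnIn U o v ↔ v ∈ S₀) {v : Fin n} (hv : v ∈ S₀) :
    ω ∈ openConnIn (↑S₀ : Set (Fin n)) o v := by
  have hp : PathIn (openGraph ω) U o v := DCT16.pathIn_of_mem_openConnIn ((hω v).2 hv)
  have hoS : o ∈ (↑S₀ : Set (Fin n)) :=
    Finset.mem_coe.2 ((hω o).1 (DCT16.mem_openConnIn_of_pathIn (PathIn.refl hp.left_mem)))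
  rcases hp.exit_or (R := (↑S₀ : Set (Fin n))) hoS with h | ⟨x, y, -, hy, hyU, hxy, hpx⟩
  · exact DCT16.mem_openConnIn_of_pathIn (h.mono Set.inter_subset_left)
  · exfalso
    have hpy : PathIn (openGraph ω) U o y := (hpx.mono Set.inter_subset_right).tail hxy hyU
    exact hy (Finset.mem_coe.2 ((hω y).1 (DCT16.mem_openConnIn_of_pathIn hpy)))

/-- **On `{pocket = S₀}` every boundary pair of the pocket is closed** (an open boundary pair
would put its outer endpoint into the pocket). -/
theorem notMem_of_pocket
    (hF₀ : ∀ x y, s(x, y) ∈ F₀ ↔ (x ∈ S₀ ∧ y ∉ S₀ ∧ y ∉ A) ∨ (y ∈ S₀ ∧ x ∉ S₀ ∧ x ∉ A))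
    {ω : Set (Sym2 (Fin n))} (hω : ∀ v, ω ∈ openConnIn (↑A : Set (Fin n))ᶜ o v ↔ v ∈ S₀)
    {e : Sym2 (Fin n)} (he : e ∈ F₀) : e ∉ ω := by
  revert he
  induction e using Sym2.ind with
  | _ x y =>
  intro he hxy
  have main : ∀ x y, x ∈ S₀ → y ∉ S₀ → y ∉ A → s(x, y) ∈ ω → False := fun x y hx hy hyA h => by
    have hp : PathIn (openGraph ω) (↑A : Set (Fin n))ᶜ o x :=
      DCT16.pathIn_of_mem_openConnIn ((hω x).2 hx)
    have hne : x ≠ y := fun h' => hy (h' ▸ hx)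
    have hpy := hp.tail ((openGraph_adj ω x y).2 ⟨h, hne⟩) (fun h' => hyA (Finset.mem_coe.1 h'))
    exact hy ((hω y).1 (DCT16.mem_openConnIn_of_pathIn hpy))
  rcases (hF₀ x y).1 he with ⟨hx, hy, hyA⟩ | ⟨hy, hx, hxA⟩
  · exact main x y hx hy hyA hxy
  · exact main y x hy hx hxA (by rw [Sym2.eq_swap]; exact hxy)

/-- **Walk lemma (the bad event survives the contraction).** On `{o ↔ A, o ↮ b} ∩ {pocket = S₀}`
the merged configuration lies in `{o ↔ A, o ↮ b}`: the first exit of an open path `o → a` from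
`S₀` goes to a vertex of `A` (boundary pairs are closed), giving an open `{o, a'}` after merging;
and an open path `o → b` after merging would start with a merged pair `{o, a'}` coming from an
open `{x, a'}`, `x ∈ S₀`, followed by pairs avoiding `S₀`, so that `o ↔ x ↔ b` in `ω`. -/
theorem merge_mem_bad
    (hΦ' : ∀ ω u v, s(u, v) ∈ Φ ω ↔ (u ∉ S₀ ∧ v ∉ S₀ ∧ s(u, v) ∈ ω) ∨
      (u = o ∧ v ∈ A ∧ ∃ x ∈ S₀, s(x, v) ∈ ω) ∨ (v = o ∧ u ∈ A ∧ ∃ x ∈ S₀, s(x, u) ∈ ω))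
    (hF₀ : ∀ x y, s(x, y) ∈ F₀ ↔ (x ∈ S₀ ∧ y ∉ S₀ ∧ y ∉ A) ∨ (y ∈ S₀ ∧ x ∉ S₀ ∧ x ∉ A))
    (ho : o ∈ S₀) (hSA : Disjoint S₀ A) {b : Fin n} {ω : Set (Sym2 (Fin n))}
    (hbad : ω ∈ (⋃ a ∈ A, openConn o a) ∩ (openConn o b)ᶜ)
    (hω : ∀ v, ω ∈ openConnIn (↑A : Set (Fin n))ᶜ o v ↔ v ∈ S₀) :
    Φ ω ∈ (⋃ a ∈ A, openConn o a) ∩ (openConn o b)ᶜ := by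
  obtain ⟨hA, hb⟩ := hbad
  simp only [mem_iUnion, exists_prop] at hA
  obtain ⟨a, haA, hoa⟩ := hA
  have hcl : ∀ e ∈ F₀, e ∉ ω := fun e he => notMem_of_pocket hF₀ hω he
  have haS : a ∉ S₀ := fun h => Finset.disjoint_left.1 hSA h haA
  obtain ⟨x, y, hx, hy, -, hxy, -⟩ := (DCT16.pathIn_univ_of_reachable hoa).exit
    (R := (↑S₀ : Set (Fin n))) (Finset.mem_coe.2 ho) (fun h => haS (Finset.mem_coe.1 h))
  rw [openGraph_adj] at hxy
  have hx' : x ∈ S₀ := Finset.mem_coe.1 hx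
  have hy' : y ∉ S₀ := fun h => hy (Finset.mem_coe.2 h)
  have hyA : y ∈ A := by
    by_contra hyA
    exact hcl _ ((hF₀ x y).2 (Or.inl ⟨hx', hy', hyA⟩)) hxy.1
  constructor
  · simp only [mem_iUnion, exists_prop]
    refine ⟨y, hyA, SimpleGraph.Adj.reachable ?_⟩
    rw [openGraph_adj]
    exact ⟨(hΦ' ω o y).2 (Or.inr (Or.inl ⟨rfl, hyA, x, hx', hxy.1⟩)), fun h => hy' (h ▸ ho)⟩
  · intro hob
    have hbo : b ≠ o := by
      rintro rfl
      exact hb (show (openGraph ω).Reachable b b from SimpleGraph.Reachable.refl _)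
    obtain ⟨a', b', ha', -, hb', hadj, hp⟩ := (DCT16.pathIn_univ_of_reachable hob).last_exit
      (C := ({o} : Set (Fin n))) (Set.mem_singleton o) (fun h => hbo (Set.mem_singleton_iff.1 h))
    rw [Set.mem_singleton_iff] at ha'
    rw [ha', openGraph_adj] at hadj
    obtain ⟨hob', -⟩ := hadj
    have hb'o : b' ≠ o := fun h => hb' (Set.mem_singleton_iff.2 h)
    rcases (hΦ' ω o b').1 hob' with ⟨hoS, -, -⟩ | ⟨-, hb'A, x', hx', hx'b'⟩ | ⟨hbo', -, -⟩
    · exact hoS ho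
    · have hp' : PathIn (openGraph ω) (Set.univ \ {o}) b' b := by
        refine DCT16.pathIn_congrGraph (fun u v hu hv huv => ?_) hp
        rw [openGraph_adj] at huv ⊢
        refine ⟨?_, huv.2⟩
        have huo : u ≠ o := fun h => hu.2 (Set.mem_singleton_iff.2 h)
        have hvo : v ≠ o := fun h => hv.2 (Set.mem_singleton_iff.2 h)
        rcases (hΦ' ω u v).1 huv.1 with ⟨-, -, h⟩ | ⟨h, -⟩ | ⟨h, -⟩
        · exact h
        · exact absurd h huo
        · exact absurd h hvo
      have h1 : (openGraph ω).Reachable x' b := by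
        refine (SimpleGraph.Adj.reachable ?_).trans (reachable_of_pathIn hp')
        rw [openGraph_adj]
        exact ⟨hx'b', fun h => Finset.disjoint_left.1 hSA hx' (h ▸ hb'A)⟩
      have h2 : (openGraph ω).Reachable o x' :=
        openConnIn_subset_openConn _ o x' (mem_openConnIn_of_pocket hω hx')
      exact hb (h2.trans h1)
    · exact hb'o hbo'

end PocketWalks

section PocketMain

variable {n : ℕ}

/-- The spanning event `{S₀ internally o-spanned}` is determined by the pairs inside `S₀`. -/
theorem determinedBy_span (S₀ : Finset (Fin n)) (o : Fin n) :
    DeterminedBy {ω : Set (Sym2 (Fin n)) | ∀ v ∈ S₀, ω ∈ openConnIn (↑S₀ : Set (Fin n)) o v}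
      (↑S₀.sym2 : Set (Sym2 (Fin n))) := by
  rw [determinedBy_iff]
  intro ω ω' h
  simp only [mem_setOf_eq]
  refine forall₂_congr fun v _ => ?_
  exact (determinedBy_iff _ _).1 (DCT16.determinedBy_openConnIn (↑S₀ : Set (Fin n)) o v
    (K := (↑S₀.sym2 : Set (Sym2 (Fin n)))) (by rw [Finset.coe_sym2])) ω ω' h

/-- **The per-pocket bound.** For a pocket value `S₀ ∋ o` disjoint from `A`, with the merge data
`π, Φ, w'` and the boundary pair set `F₀` of `S₀`:
`μ({o ↔ A, o ↮ b} ∩ {pocket = S₀}) ≤ t · μ(S₀ internally o-spanned)`, granted depth-one gluing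
(the hypothesis `hglue`). Proof: `{bad} ∩ {pocket = S₀} ⊆ {span} ∩ {∂S₀ closed} ∩ Φ⁻¹{bad}`
(walk lemma `merge_mem_bad`), the three events are determined by disjoint pair sets, the law of
`Φ` is `prodBernoulli w'` (`prodBernoulli_real_preimage_fiberMap`), in which `o` is joined only to
`A` and each `a ∈ A` has `μ'(a ↮ b) · μ(∂S₀ closed) ≤ μ(a ↮ b) ≤ t` (walk lemma
`merge_mem_openConn`), so that depth-one gluing gives `μ(∂S₀ closed) · μ'(bad) ≤ t`. -/
theorem pocket_term_le
    (hglue : ∀ (n : ℕ) (w : Sym2 (Fin n) → unitInterval) (A : Finset (Fin n)) (s b : Fin n) (t : ℝ),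
      0 ≤ t →
      (∀ x : Fin n, x ∉ A → x ≠ s → w s(s, x) = 0) →
      (∀ a ∈ A, (prodBernoulli w).real (openConn a b)ᶜ ≤ t) →
      (prodBernoulli w).real ((⋃ a ∈ A, openConn s a) ∩ (openConn s b)ᶜ) ≤ t)
    (w : Sym2 (Fin n) → unitInterval) {S₀ A : Finset (Fin n)} {o b : Fin n} {t : ℝ} (ht : 0 ≤ t)
    (ho : o ∈ S₀) (hSA : Disjoint S₀ A)
    (hrel : ∀ a ∈ A, (prodBernoulli w).real (openConn a b)ᶜ ≤ t)
    {π : Sym2 (Fin n) → Option (Sym2 (Fin n))} {Φ : Set (Sym2 (Fin n)) → Set (Sym2 (Fin n))}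
    {w' : Sym2 (Fin n) → unitInterval} {F₀ : Finset (Sym2 (Fin n))}
    (hπ1 : ∀ x y, x ∉ S₀ → y ∉ S₀ → π s(x, y) = some s(x, y))
    (hπ2 : ∀ x y, x ∈ S₀ → y ∈ A → π s(x, y) = some s(o, y))
    (hπ3 : ∀ x y k, π s(x, y) = some k → (x ∉ S₀ ∧ y ∉ S₀ ∧ k = s(x, y)) ∨
      (x ∈ S₀ ∧ y ∈ A ∧ k = s(o, y)) ∨ (y ∈ S₀ ∧ x ∈ A ∧ k = s(o, x)))
    (hΦ : ∀ ω k, k ∈ Φ ω ↔ ∃ e ∈ ω, π e = some k)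
    (hw' : ∀ k, (w' k : ℝ) = 1 - ∏ e ∈ Finset.univ.filter (fun e => π e = some k), (1 - (w e : ℝ)))
    (hF₀ : ∀ x y, s(x, y) ∈ F₀ ↔ (x ∈ S₀ ∧ y ∉ S₀ ∧ y ∉ A) ∨ (y ∈ S₀ ∧ x ∉ S₀ ∧ x ∉ A)) :
    (prodBernoulli w).real (((⋃ a ∈ A, openConn o a) ∩ (openConn o b)ᶜ) ∩
        {ω | ∀ v : Fin n, ω ∈ openConnIn (↑A : Set (Fin n))ᶜ o v ↔ v ∈ S₀}) ≤
      t * (prodBernoulli w).real {ω | ∀ v ∈ S₀, ω ∈ openConnIn (↑S₀ : Set (Fin n)) o v} := by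
  set μ := prodBernoulli w with hμ
  set Span : Set (Set (Sym2 (Fin n))) := {ω | ∀ v ∈ S₀, ω ∈ openConnIn (↑S₀ : Set (Fin n)) o v}
    with hSpan
  set Cl : Set (Set (Sym2 (Fin n))) := {ω | ∀ e ∈ F₀, e ∉ ω} with hCl
  set Bad : Set (Set (Sym2 (Fin n))) := (⋃ a ∈ A, openConn o a) ∩ (openConn o b)ᶜ with hBad
  set Pock : Set (Set (Sym2 (Fin n))) :=
    {ω | ∀ v : Fin n, ω ∈ openConnIn (↑A : Set (Fin n))ᶜ o v ↔ v ∈ S₀} with hPock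
  -- the case `b ∈ S₀`: the event is empty
  by_cases hbS : b ∈ S₀
  · have h0 : Bad ∩ Pock ⊆ ∅ := fun ω ⟨hbad, hω⟩ =>
      hbad.2 (openConnIn_subset_openConn _ o b (mem_openConnIn_of_pocket hω hbS))
    refine le_trans (measureReal_mono h0) ?_
    rw [measureReal_empty]
    exact mul_nonneg ht measureReal_nonneg
  have hΦ' := mk_mem_merge_iff hπ1 hπ2 hπ3 hΦ
  have hkey : ∀ Y, μ.real (Φ ⁻¹' Y) = (prodBernoulli w').real Y :=
    prodBernoulli_real_preimage_fiberMap w w' π Φ hΦ hw'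
  have hdetΦ : ∀ Y, DeterminedBy (Φ ⁻¹' Y) (↑(S₀.sym2 ∪ F₀)ᶜ : Set (Sym2 (Fin n))) :=
    determinedBy_preimage_merge hπ3 hΦ hF₀ hSA
  -- pair-set bookkeeping
  have hF₀S : (↑F₀ : Set (Sym2 (Fin n))) ⊆ (↑S₀.sym2 : Set (Sym2 (Fin n)))ᶜ := by
    intro e he heS
    rw [Finset.mem_coe] at he heS
    revert he heS
    induction e using Sym2.ind with
    | _ x y =>
    intro he heS
    rw [Finset.mk_mem_sym2_iff] at heS
    rcases (hF₀ x y).1 he with ⟨-, hy, -⟩ | ⟨-, hx, -⟩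
    exacts [hy heS.2, hx heS.1]
  have hES : (↑(S₀.sym2 ∪ F₀)ᶜ : Set (Sym2 (Fin n))) ⊆ (↑S₀.sym2 : Set (Sym2 (Fin n)))ᶜ := by
    intro e he heS
    rw [Finset.coe_compl, mem_compl_iff, Finset.coe_union, mem_union] at he
    exact he (Or.inl heS)
  have hEF : (↑(S₀.sym2 ∪ F₀)ᶜ : Set (Sym2 (Fin n))) ⊆ (↑F₀ : Set (Sym2 (Fin n)))ᶜ := by
    intro e he heF
    rw [Finset.coe_compl, mem_compl_iff, Finset.coe_union, mem_union] at he
    exact he (Or.inr heF)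
  -- independence
  have hI1 : μ.real (Span ∩ (Cl ∩ Φ ⁻¹' Bad)) = μ.real Span * μ.real (Cl ∩ Φ ⁻¹' Bad) :=
    prodBernoulli_real_inter_of_determinedBy w S₀.sym2 (determinedBy_span S₀ o)
      (((determinedBy_forall_notMem F₀).mono hF₀S).inter ((hdetΦ Bad).mono hES))
      MeasurableSet.of_discrete MeasurableSet.of_discrete
  have hI2 : ∀ Y, μ.real (Cl ∩ Φ ⁻¹' Y) = μ.real Cl * μ.real (Φ ⁻¹' Y) := fun Y =>
    prodBernoulli_real_inter_of_determinedBy w F₀ (determinedBy_forall_notMem F₀)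
      ((hdetΦ Y).mono hEF) MeasurableSet.of_discrete MeasurableSet.of_discrete
  -- the heart: depth-one gluing in the merged world
  have heart : μ.real Cl * (prodBernoulli w').real Bad ≤ t := by
    by_cases hc : μ.real Cl = 0
    · rw [hc, zero_mul]; exact ht
    have hcpos : 0 < μ.real Cl := lt_of_le_of_ne measureReal_nonneg (Ne.symm hc)
    have hrel' : ∀ a ∈ A, (prodBernoulli w').real (openConn a b)ᶜ ≤ t / μ.real Cl := by
      intro a ha
      have haS : a ∉ S₀ := fun h => Finset.disjoint_left.1 hSA h ha
      rw [le_div_iff₀ hcpos, ← hkey, mul_comm, ← hI2]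
      refine le_trans (measureReal_mono ?_) (hrel a ha)
      rintro ω ⟨hωcl, hΦω⟩ hab
      exact hΦω (merge_mem_openConn hΦ' hF₀ ho haS hbS hab hωcl)
    have hiso : ∀ x : Fin n, x ∉ A → x ≠ o → w' s(o, x) = 0 := by
      intro x hxA hxo
      have h := hw' s(o, x)
      rw [Finset.filter_eq_empty_iff.2 (fun e _ => merge_ne_some hπ3 ho hxA hxo e),
        Finset.prod_empty, sub_self] at h
      exact Set.Icc.coe_eq_zero.1 h
    have h := hglue n w' A o b (t / μ.real Cl) (div_nonneg ht measureReal_nonneg) hiso hrel'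
    rw [le_div_iff₀ hcpos, mul_comm] at h
    exact h
  -- assemble
  have hsub : Bad ∩ Pock ⊆ Span ∩ (Cl ∩ Φ ⁻¹' Bad) := fun ω ⟨hbad, hω⟩ =>
    ⟨fun v hv => mem_openConnIn_of_pocket hω hv, fun e he => notMem_of_pocket hF₀ hω he,
      merge_mem_bad hΦ' hF₀ ho hSA hbad hω⟩
  calc μ.real (Bad ∩ Pock) ≤ μ.real (Span ∩ (Cl ∩ Φ ⁻¹' Bad)) := measureReal_mono hsub
    _ = μ.real Span * (μ.real Cl * (prodBernoulli w').real Bad) := by rw [hI1, hI2, hkey]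
    _ ≤ μ.real Span * t := mul_le_mul_of_nonneg_left heart measureReal_nonneg
    _ = t * μ.real Span := mul_comm _ _

end PocketMain

/-- THE POCKET BOUND (lead, 2026-08-16; new): decomposing by the relay-free pocket `S = C_{V∖A}(o)` and applying depth-one gluing to the pocket contracted to a point gives `P(o ↔ A, o ↮ b) ≤ Σ_{S₀ ∋ o, S₀ ∩ A = ∅} min(P(S = S₀), t·P(S₀ internally o-spanned))`, `t = max_a P(a ↮ b)`. Takes depth-one gluing as hypothesis. [folklore] -/
theorem pocketBound :
    (∀ (n : ℕ) (w : Sym2 (Fin n) → unitInterval) (A : Finset (Fin n)) (s b : Fin n) (t : ℝ),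
      0 ≤ t →
      (∀ x : Fin n, x ∉ A → x ≠ s → w s(s, x) = 0) →
      (∀ a ∈ A, (Literature.Probability.LatticeModels.prodBernoulli w).real
          (Literature.Probability.Percolation.openConn a b)ᶜ ≤ t) →
      (Literature.Probability.LatticeModels.prodBernoulli w).real
          ((⋃ a ∈ A, Literature.Probability.Percolation.openConn s a) ∩
            (Literature.Probability.Percolation.openConn s b)ᶜ) ≤ t) →
    ∀ (n : ℕ) (w : Sym2 (Fin n) → unitInterval) (A : Finset (Fin n)) (o b : Fin n) (t : ℝ),
      0 ≤ t → o ∉ A →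
      (∀ a ∈ A, (Literature.Probability.LatticeModels.prodBernoulli w).real
          (Literature.Probability.Percolation.openConn a b)ᶜ ≤ t) →
      (Literature.Probability.LatticeModels.prodBernoulli w).real
          ((⋃ a ∈ A, Literature.Probability.Percolation.openConn o a) ∩
            (Literature.Probability.Percolation.openConn o b)ᶜ) ≤
        ∑ S₀ ∈ (Finset.univ : Finset (Finset (Fin n))).filter (fun S₀ => o ∈ S₀ ∧ Disjoint S₀ A),
          min ((Literature.Probability.LatticeModels.prodBernoulli w).real
                {ω | ∀ v : Fin n, ω ∈ Literature.Probability.Percolation.openConnIn (↑A)ᶜ o v ↔ v ∈ S₀})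
              (t * (Literature.Probability.LatticeModels.prodBernoulli w).real
                {ω | ∀ v ∈ S₀, ω ∈ Literature.Probability.Percolation.openConnIn ↑S₀ o v}) := by
  intro hglue n w A o b t ht hoA hrel
  set Bad : Set (Set (Sym2 (Fin n))) := (⋃ a ∈ A, openConn o a) ∩ (openConn o b)ᶜ with hBad
  have hoU : o ∈ (↑A : Set (Fin n))ᶜ := fun h => hoA (Finset.mem_coe.1 h)
  -- partition according to the value of the pocket
  have hcover : Bad ⊆ ⋃ S₀ ∈ (Finset.univ : Finset (Finset (Fin n))).filter
      (fun S₀ => o ∈ S₀ ∧ Disjoint S₀ A),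
      (Bad ∩ {ω | ∀ v : Fin n, ω ∈ openConnIn (↑A : Set (Fin n))ᶜ o v ↔ v ∈ S₀}) := by
    intro ω hω
    simp only [mem_iUnion, exists_prop, Finset.mem_filter, Finset.mem_univ, true_and]
    refine ⟨Finset.univ.filter (fun v => ω ∈ openConnIn (↑A : Set (Fin n))ᶜ o v), ⟨?_, ?_⟩,
      hω, fun v => by simp⟩
    · simp only [Finset.mem_filter, Finset.mem_univ, true_and]
      exact ⟨hoU, hoU, SimpleGraph.Reachable.refl _⟩
    · refine Finset.disjoint_left.2 fun v hv hvA => ?_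
      simp only [Finset.mem_filter, Finset.mem_univ, true_and] at hv
      obtain ⟨-, hvU, -⟩ := hv
      exact hvU (Finset.mem_coe.2 hvA)
  refine le_trans (measureReal_mono hcover (measure_ne_top _ _))
    (le_trans (measureReal_biUnion_finset_le _ _) ?_)
  refine Finset.sum_le_sum fun S₀ hS₀ => ?_
  simp only [Finset.mem_filter, Finset.mem_univ, true_and] at hS₀
  obtain ⟨hoS, hSA⟩ := hS₀
  refine le_min (measureReal_mono Set.inter_subset_right) ?_
  obtain ⟨π, hπ1, hπ2, hπ3⟩ := exists_mergeFiber S₀ A o hSA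
  obtain ⟨w', hw'⟩ := exists_fiberWeights w π
  obtain ⟨F₀, hF₀⟩ := exists_boundaryPairs S₀ A
  exact pocket_term_le hglue w ht hoS hSA hrel hπ1 hπ2 hπ3
    (Φ := fun ω => {k | ∃ e ∈ ω, π e = some k}) (fun _ _ => Iff.rfl) hw' hF₀

end Summit.CriticalPhenomena.PercolationContinuityZ3.Theorems
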